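import Summits.QuantumFields.YangMills.Theorems.BalabanLadderIRPinnedExitCofinal
import Summits.QuantumFields.YangMills.Theorems.BalabanLadderIRAfOnsetLatticeAF
import Summits.QuantumFields.YangMills.Theorems.ColdExitSC.Negative.UniformExitFalseOfHeavyTwistPinnedRate
import Summits.QuantumFields.YangMills.Theses.BalabanLadder
import HarnessLib

/-!
# Crux `IRcof` (stmt-QuantumFields-26930) — LENS 3 «RG EXIT → COLD PRESSURE» sheet (ideator ymfull-r2c-lens-3 g0; NODE contract D-0171)
# `PXcof(θ) ⇐ RGExitLadderAt θ` := ∃ ONE renormalised trajectory `K ↦ β_K` with (E) `ExitPurityInf` ∧ (Xπ) `TrajectoryPin`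

DICTIONARY (Bałaban flow ↦ tree objects).  A renormalised trajectory is a blocking factor `b ≥ 2`, an exit-box size `N ≥ 2`
(in EXIT sites) and bare couplings `β_K → ∞` (intended: `K` Bałaban steps from `β_K` land at one fixed exit coupling `γ`, i.e.
`b^K ≍ ξ(β_K)` — a line of constant physics; NOT typed, the trajectory is `∃`-quantified).  The exit theory's partition
functions ARE the lattice ones (RG is an exact rewriting), so «the N-site exit 4:1 box is θ-pure» is LITERALLY
`coldDefect r.ρ β_K (4·N·b^K) ≤ θ`, and «cofinally in β» becomes «for infinitely many RG depths K» = a `liminf` over K —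
immune to UV NON-uniqueness (any vacuum-dominated subsequential exit theory suffices; the eventual slot 19354 would need all).

PIECES (tags per D-0171):
* (E)  `ExitPurityInf`  — UNDECIDED ∕ INSTRUMENTABLE: THE NUMBER at width 0 in EXIT units along one trajectory (K-uniform exit-unit
        cold pressure of the exit actions; the `(2S+1)³` lattice-volume prefactor of the tree schema `ColdPressureBound` diverges
        along a trajectory — the estimate must carry the EXIT volume `N³`).  Instrument: blocked (MCRG ∕ line-of-constant-physics)
        4:1 purity `δ(β_K, 4N·2^K)`, K = 0,1,2.  Not smaller than PXcof's IR content; it is WHERE an RG proof would compute it.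
* (Xπ) `TrajectoryPin`  — WEAKER ∕ ATTACKABLE (UV, Bałaban class + E0′ observable bounds): every floor-carrying unit is finer than
        `T` exit lengths along the trajectory («AF down to the exit scale»).  PROVED here in the femto-fast regime
        (`trajectoryPin_of_fast`, from the tree's bare ceiling `AfOnset.exists_abs_Q2_le_log_sq`); open content = LCP-slow trajectories
        (running coupling, scales between `β^{1/4}` and `e^{cβ}` lattice sites).
* composition `pxcof_of_rgExitLadder` — PROVED (bookkeeping); §4 `not_exitPurityInf_of_linear_outrun` (p621160 instantiated) and §5
  `exitsUnboundedAt_of_rgExitLadder` ((E) refines the bench's K1) — PROVED.  `RGExitLadderAt θ` as a whole: EQUIV-in-content to PXcof(θ) restricted to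
  geometric box ladders (re-cut + dictionary, no new inequality) — COSTUME risk recorded, not hidden.
HONEST FRAMING: finite-volume ∕ conditional bookkeeping only; nothing here proves `IRcof`, `IR`, any leg, or the Yang–Mills mass gap.
-/

set_option autoImplicit false

noncomputable section

open Filter Topology MeasureTheory
open scoped SchwartzMap
open Literature.MathematicalPhysics.QuantumFieldTheory Literature.MathematicalPhysics.QuantumLattice
open Summit.QuantumFields.YangMills.Cruxes.OSLegsFromFemtoAndGap.DlrCollarTransfer (LowerBounds Q2)
open Summit.QuantumFields.YangMills.Cruxes.IR.ColdPurityBridge (coldDefect)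
open Summit.QuantumFields.YangMills.Cruxes.IR.AfOnset (exists_abs_Q2_le_log_sq)
open Summit.QuantumFields.YangMills.Theorems.ColdExitSC.Negative.HeavyTwist (pure_box_is_long_holds)

namespace Summit.QuantumFields.YangMills.Cruxes.IRcof.RGExitColdPressure

/-! ## §0 The slot's target, verbatim (`PinnedCofinalBill.PinnedExitsCofinalAt`, d3255819134117aa) -/

/-- **PXcof(θ)** — verbatim copy of the slot's `PinnedCofinalBill.PinnedExitsCofinalAt θ`. -/
def PinnedExitsCofinalAt (θ : ℝ) : Prop :=
  ∀ (G : Type) [Group G] [TopologicalSpace G] [IsTopologicalGroup G] [CompactSpace G],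
    IsCompactSimpleLieGroup G → SimplyConnectedSpace G →
    letI : MeasurableSpace G := borel G
    haveI : BorelSpace G := ⟨rfl⟩
    ∀ (r : LatticeRep G) (a : ℝ → ℝ), (∀ β, 0 < a β) → Tendsto a atTop (𝓝 0) → LowerBounds G r a →
      ∃ T : ℝ, ∀ β₁ : ℝ, ∃ β : ℝ, β₁ ≤ β ∧ ∃ L : ℕ, 8 ≤ L ∧ a β * (L : ℝ) ≤ T ∧ coldDefect r.ρ β L ≤ θ

/-! ## §1 The trajectory objects -/

/-- Side (lattice units) of the cold `4:1` box whose TIME extent is `N` exit sites at RG depth `K`: `4·N·b^K`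
(so `coldDefect`'s `L/4 = N·b^K` exactly, no rounding). -/
def exitBox (b N K : ℕ) : ℕ := 4 * N * b ^ K

theorem eight_le_exitBox {b N : ℕ} (hb : 2 ≤ b) (hN : 2 ≤ N) (K : ℕ) : 8 ≤ exitBox b N K := by
  unfold exitBox
  have h1 : 1 ≤ b ^ K := Nat.one_le_pow _ _ (by omega)
  nlinarith

section Pieces

variable {G : Type} [Group G] [TopologicalSpace G] [IsTopologicalGroup G] [CompactSpace G]
  [MeasurableSpace G] [BorelSpace G]

/-- **(E) `ExitPurityInf ρ b N β θ` — exit-box purity for infinitely many RG depths** (`liminf_K δ(β_K, 4N b^K) ≤ θ`, typed cofinally):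
for every `K₀` some depth `K ≥ K₀` has the `N`-exit-site cold `4:1` box `θ`-pure at the bare coupling `β_K`.
IR content (THE NUMBER in exit units, width 0); no unit map, no floor. -/
def ExitPurityInf {n : ℕ} (ρ : G →* Matrix (Fin n) (Fin n) ℂ) (b N : ℕ) (β : ℕ → ℝ) (θ : ℝ) : Prop :=
  ∀ K₀ : ℕ, ∃ K : ℕ, K₀ ≤ K ∧ coldDefect ρ (β K) (exitBox b N K) ≤ θ

/-- **(Xπ) `TrajectoryPin r b N β` — the AF pin along the trajectory**: every positive unit map `a → 0` carrying the floor
`LowerBounds G r a` measures the exit box as at most `T(a)` units, eventually in the depth `K`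
(«no floor at sub-exit scales»: UV running-coupling content once the trajectory is a line of constant physics). -/
def TrajectoryPin (r : LatticeRep G) (b N : ℕ) (β : ℕ → ℝ) : Prop :=
  ∀ a : ℝ → ℝ, (∀ t, 0 < a t) → Tendsto a atTop (𝓝 0) → LowerBounds G r a →
    ∃ T : ℝ, ∀ᶠ K : ℕ in atTop, a (β K) * ((exitBox b N K : ℕ) : ℝ) ≤ T

end Pieces

/-- **`RGExitLadderAt θ`** — for every simply-connected compact simple `G` and every `r`, ONE trajectory `(b, N, β_K → ∞)` carries
both (E) and (Xπ).  (The joint `∃` is where the line-of-constant-physics tuning lives; see the sheet header.) -/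
def RGExitLadderAt (θ : ℝ) : Prop :=
  ∀ (G : Type) [Group G] [TopologicalSpace G] [IsTopologicalGroup G] [CompactSpace G],
    IsCompactSimpleLieGroup G → SimplyConnectedSpace G →
    letI : MeasurableSpace G := borel G
    haveI : BorelSpace G := ⟨rfl⟩
    ∀ r : LatticeRep G, ∃ (b N : ℕ) (β : ℕ → ℝ), 2 ≤ b ∧ 2 ≤ N ∧ Tendsto β atTop atTop ∧
      ExitPurityInf r.ρ b N β θ ∧ TrajectoryPin r b N β

/-! ## §2 Composition onto the slot's stub statement (PROVED) -/

/-- **`RGExitLadderAt θ → PXcof(θ)`**: the pin `T(a)` holds for `K ≥ K₁`, `β_K ≥ β₁` for `K ≥ K₂`, and (E) supplies a pure exit box at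
some `K ≥ max K₁ K₂`. -/
theorem pxcof_of_rgExitLadder {θ : ℝ} (h : RGExitLadderAt θ) : PinnedExitsCofinalAt θ := by
  intro G _ _ _ _ hG hsc
  letI : MeasurableSpace G := borel G
  haveI : BorelSpace G := ⟨rfl⟩
  intro r a ha ha0 hlb
  obtain ⟨b, N, β, hb, hN, hβ, hE, hX⟩ := h G hG hsc r
  obtain ⟨T, hT⟩ := hX a ha ha0 hlb
  refine ⟨T, fun β₁ => ?_⟩
  have hβ₁ : ∀ᶠ K : ℕ in atTop, β₁ ≤ β K := hβ.eventually (eventually_ge_atTop β₁)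
  obtain ⟨K₀, hK₀⟩ := eventually_atTop.1 (hT.and hβ₁)
  obtain ⟨K, hK, hδ⟩ := hE K₀
  exact ⟨β K, (hK₀ K hK).2, exitBox b N K, eight_le_exitBox hb hN K, (hK₀ K hK).1, hδ⟩

/-- The stub of this sheet's line (THE content; (E) ∧ (Xπ) on one trajectory). -/
theorem stub_rgExitLadder : RGExitLadderAt (1 / 24) := by
  sorry

/-- Onto the slot's first stub statement, by name of this sheet's verbatim copy. -/
theorem pxcof24_of_stub : PinnedExitsCofinalAt (1 / 24) :=
  pxcof_of_rgExitLadder stub_rgExitLadder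

/-! ## §3 PROVED rung for (Xπ): femto-fast trajectories are pinned by the tree's BARE ceiling

If `β_K` outruns the exit box polynomially — `C·(4N b^K)⁸·(1+log β_K)² ≤ β_K²` eventually, for every `C` — then along the trajectory every
floor-carrying unit has `a(β_K)·(4N b^K) ≤ 1` eventually: a floor `ε ≤ Q2` at unit `a(β_K)` on large tori contradicts
`|Q2| ≤ K(1+log β)²/(β²·min(s,1)⁸)` (`AfOnset.exists_abs_Q2_le_log_sq`).  This is the regime where (E) FAILS (femto boxes are not pure):
the rung certifies the SHAPE of (Xπ) and locates its open content — trajectories as slow as a line of constant physics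
(`b^K ≍ e^{cβ_K}`), i.e. the running-coupling ceiling between `β^{1/4}` and `e^{cβ}` lattice sites (Bałaban class, E0′-type bounds). -/
theorem trajectoryPin_of_fast {G : Type} [Group G] [TopologicalSpace G] [IsTopologicalGroup G] [CompactSpace G]
    [MeasurableSpace G] [BorelSpace G] (r : LatticeRep G) (b N : ℕ) (β : ℕ → ℝ) (hβ : Tendsto β atTop atTop)
    (hfast : ∀ C : ℝ, ∀ᶠ K : ℕ in atTop,
      C * ((exitBox b N K : ℕ) : ℝ) ^ 8 * (1 + Real.log (β K)) ^ 2 ≤ (β K) ^ 2)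
    (hbox : ∀ K, 1 ≤ exitBox b N K) :
    TrajectoryPin r b N β := by
  intro a ha ha0 hlb
  obtain ⟨⟨v, ε, β₅, Λ₅, hv, hε, hfloor⟩, -⟩ := hlb
  obtain ⟨Kc, hKc0, hKc⟩ := exists_abs_Q2_le_log_sq r (thetaTest 4 v) v
  refine ⟨1, ?_⟩
  have h1 : ∀ᶠ K : ℕ in atTop, (1 : ℝ) ≤ β K := hβ.eventually (eventually_ge_atTop 1)
  have h5 : ∀ᶠ K : ℕ in atTop, β₅ ≤ β K := hβ.eventually (eventually_ge_atTop β₅)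
  filter_upwards [h1, h5, hfast ((Kc + 1) / ε)] with K hK1 hK5 hKf
  by_contra hnot
  push Not at hnot
  -- notation
  set s : ℝ := a (β K) with hs
  set E : ℝ := ((exitBox b N K : ℕ) : ℝ) with hE
  set B : ℝ := β K with hB
  have hs0 : 0 < s := ha _
  have hE1 : (1 : ℝ) ≤ E := by
    rw [hE]; exact_mod_cast hbox K
  have hE0 : 0 < E := lt_of_lt_of_le one_pos hE1
  -- a large torus carrying the floor at unit `s`
  set L : ℕ := max 1 ⌈Λ₅ / s⌉₊ with hL
  have hL1 : 1 ≤ L := le_max_left _ _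
  have hΛ : Λ₅ ≤ s * (L : ℝ) := by
    have hceil : Λ₅ / s ≤ (⌈Λ₅ / s⌉₊ : ℝ) := Nat.le_ceil _
    have hLc : (⌈Λ₅ / s⌉₊ : ℝ) ≤ (L : ℝ) := by exact_mod_cast le_max_right 1 ⌈Λ₅ / s⌉₊
    calc Λ₅ = s * (Λ₅ / s) := by field_simp
      _ ≤ s * (L : ℝ) := mul_le_mul_of_nonneg_left (hceil.trans hLc) hs0.le
  have hfl : ε ≤ Q2 G r B L s (thetaTest 4 v) v := hfloor B hK5 L hΛ
  have hce : |Q2 G r B L s (thetaTest 4 v) v| ≤ Kc * (1 + Real.log B) ^ 2 / (B ^ 2 * (min s 1) ^ 8) :=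
    hKc L hL1 B hK1 s hs0
  -- the unit is coarse: `min s 1 ≥ 1/E`
  have hmin : 1 / E ≤ min s 1 := by
    refine le_min ?_ ?_
    · exact ((div_lt_iff₀ hE0).2 (by linarith)).le
    · rw [div_le_iff₀ hE0]; linarith
  set M : ℝ := (min s 1) ^ 8 with hM
  have hMpos : 0 < M := pow_pos (lt_min hs0 one_pos) 8
  have hpow : (1 / E) ^ 8 ≤ M := pow_le_pow_left₀ (by positivity) hmin 8
  have ha8 : 1 ≤ M * E ^ 8 := by
    have h := mul_le_mul_of_nonneg_right hpow (pow_nonneg hE0.le 8)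
    have h1E : (1 / E) ^ 8 * E ^ 8 = 1 := by
      rw [div_pow, one_pow, div_mul_cancel₀]
      exact pow_ne_zero 8 hE0.ne'
    linarith [h, h1E]
  set Lg : ℝ := (1 + Real.log B) ^ 2 with hLg
  have hLg1 : 1 ≤ Lg := by
    have hlog : 0 ≤ Real.log B := Real.log_nonneg hK1
    have : (1 : ℝ) ≤ 1 + Real.log B := by linarith
    calc (1 : ℝ) = 1 ^ 2 := by norm_num
      _ ≤ (1 + Real.log B) ^ 2 := pow_le_pow_left₀ zero_le_one this 2
  have hB0 : 0 < B := lt_of_lt_of_le one_pos hK1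
  -- the fast hypothesis, cleared of the division
  have hb' : (Kc + 1) * E ^ 8 * Lg ≤ ε * B ^ 2 := by
    have h := mul_le_mul_of_nonneg_left hKf hε.le
    calc (Kc + 1) * E ^ 8 * Lg = ε * ((Kc + 1) / ε * E ^ 8 * Lg) := by field_simp
      _ ≤ ε * B ^ 2 := h
  have hlt : Kc * Lg / (B ^ 2 * M) < ε := by
    rw [div_lt_iff₀ (by positivity)]
    calc Kc * Lg < (Kc + 1) * Lg := by nlinarith
      _ = (Kc + 1) * Lg * 1 := by ring
      _ ≤ (Kc + 1) * Lg * (M * E ^ 8) := mul_le_mul_of_nonneg_left ha8 (by positivity)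
      _ = ((Kc + 1) * E ^ 8 * Lg) * M := by ring
      _ ≤ (ε * B ^ 2) * M := mul_le_mul_of_nonneg_right hb' hMpos.le
      _ = ε * (B ^ 2 * M) := by ring
  have hQ : Q2 G r B L s (thetaTest 4 v) v < ε :=
    lt_of_le_of_lt (le_trans (le_abs_self _) hce) hlt
  exact absurd hfl (not_le.mpr hQ)

/-! ## §4 The line-of-constant-physics window is FORCED (tree negative p621160 instantiated; PROVED)

Along a trajectory that outruns its exit box linearly (`204·(4N b^K) ≤ β_K` eventually) piece (E) is FALSE at every `θ ≤ 1/24` for `SU(2)`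
fundamental: a `1/24`-pure cold box has `L > β/204` (`HeavyTwist.pure_box_is_long_holds`).  With §3: the BARE ceiling pins exactly the trajectories on
which (E) is refuted, so the content of the line sits on trajectories with `β_K = O(4N b^K)` — in Yang–Mills, lines of constant physics
`b^K ≍ e^{cβ_K}` — where (Xπ) needs the RUNNING-coupling ceiling (open; Bałaban class) and (E) is THE NUMBER in exit units. -/
theorem not_exitPurityInf_of_linear_outrun (b N : ℕ) (β : ℕ → ℝ) {θ : ℝ} (hθ : θ ≤ 1 / 24)
    (hβ : Tendsto β atTop atTop) (hout : ∀ᶠ K : ℕ in atTop, 204 * ((exitBox b N K : ℕ) : ℝ) ≤ β K)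
    (hbox : ∀ K, 8 ≤ exitBox b N K) :
    letI : MeasurableSpace (Matrix.specialUnitaryGroup (Fin 2) ℂ) := borel _
    haveI : BorelSpace (Matrix.specialUnitaryGroup (Fin 2) ℂ) := ⟨rfl⟩
    ¬ ExitPurityInf (fundamentalLatticeRep 2).ρ b N β θ := by
  letI : MeasurableSpace (Matrix.specialUnitaryGroup (Fin 2) ℂ) := borel _
  haveI : BorelSpace (Matrix.specialUnitaryGroup (Fin 2) ℂ) := ⟨rfl⟩
  intro hE
  obtain ⟨β₀, hβ₀⟩ := pure_box_is_long_holds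
  have h0 : ∀ᶠ K : ℕ in atTop, β₀ ≤ β K := hβ.eventually (eventually_ge_atTop β₀)
  obtain ⟨K₀, hK₀⟩ := eventually_atTop.1 (hout.and h0)
  obtain ⟨K, hK, hδ⟩ := hE K₀
  have hlong : β K / 204 < ((exitBox b N K : ℕ) : ℝ) := hβ₀ (β K) (hK₀ K hK).2 (exitBox b N K) (hbox K) (hδ.trans hθ)
  have hout' : 204 * ((exitBox b N K : ℕ) : ℝ) ≤ β K := (hK₀ K hK).1
  linarith

/-! ## §5 Position vs the bench's K1 (rows 24∕28∕36): the (E)-half alone, on any divergent trajectory, gives `ExitsUnboundedAt` (PROVED)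

`ExitsUnboundedAt θ` restated by text (verbatim `CofinalLeaf.ExitsUnboundedAt` ∕ `CouplingClopen.ExitsUnboundedAt`, same normalised signature).  So (E) REFINES K1 by
prescribing the coupling (`β_K` on the trajectory) and the box (`4N b^K`); the pin (Xπ) is what K1 lacks and PXcof has. -/
def ExitsUnboundedAt (θ : ℝ) : Prop :=
  ∀ (G : Type) [Group G] [TopologicalSpace G] [IsTopologicalGroup G] [CompactSpace G],
    IsCompactSimpleLieGroup G → SimplyConnectedSpace G →
    letI : MeasurableSpace G := borel G
    haveI : BorelSpace G := ⟨rfl⟩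
    ∀ r : LatticeRep G, ∀ β₁ : ℝ, ∃ β : ℝ, β₁ ≤ β ∧ ∃ L : ℕ, 8 ≤ L ∧ coldDefect r.ρ β L ≤ θ

/-- (E) on divergent trajectories ⇒ K1 (no pin, no floor used). -/
theorem exitsUnboundedAt_of_exitPurity {θ : ℝ}
    (h : ∀ (G : Type) [Group G] [TopologicalSpace G] [IsTopologicalGroup G] [CompactSpace G],
      IsCompactSimpleLieGroup G → SimplyConnectedSpace G →
      letI : MeasurableSpace G := borel G
      haveI : BorelSpace G := ⟨rfl⟩
      ∀ r : LatticeRep G, ∃ (b N : ℕ) (β : ℕ → ℝ), 2 ≤ b ∧ 2 ≤ N ∧ Tendsto β atTop atTop ∧ ExitPurityInf r.ρ b N β θ) :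
    ExitsUnboundedAt θ := by
  intro G _ _ _ _ hG hsc
  letI : MeasurableSpace G := borel G
  haveI : BorelSpace G := ⟨rfl⟩
  intro r β₁
  obtain ⟨b, N, β, hb, hN, hβ, hE⟩ := h G hG hsc r
  obtain ⟨K₀, hK₀⟩ := eventually_atTop.1 (hβ.eventually (eventually_ge_atTop β₁))
  obtain ⟨K, hK, hδ⟩ := hE K₀
  exact ⟨β K, hK₀ K hK, exitBox b N K, eight_le_exitBox hb hN K, hδ⟩

/-- `RGExitLadderAt θ → ExitsUnboundedAt θ` (drop the pin). -/
theorem exitsUnboundedAt_of_rgExitLadder {θ : ℝ} (h : RGExitLadderAt θ) : ExitsUnboundedAt θ := by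
  refine exitsUnboundedAt_of_exitPurity fun G _ _ _ _ hG hsc => ?_
  intro r
  obtain ⟨b, N, β, hb, hN, hβ, hE, -⟩ := h G hG hsc r
  exact ⟨b, N, β, hb, hN, hβ, hE⟩

/-! ## §6 Card `kp-exit` (mechanism supplier for (E)): EXIT-UNIT COLD PRESSURE ⇒ (E) with `N = O(1)` exit lengths (PROVED seam; ONE named stub)

The format finding of lens 3 typed: along a trajectory the tree's `ColdPressureBound` (prefactor `(2S+1)³` = lattice volume) is useless; the
K-uniform statement must carry the EXIT volume `N'³`.  `ExitColdPressureAt ρ b β C c K`: at depth `K`, EVERY cold `4:1` box of `N'` exit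
lengths has defect `≤ C·N'³·e^{−c N'}` — the output of a Kotecký–Preiss cluster expansion of the exit theory on coarse tori (card `kp-exit`,
K-A: the exit polymer activities are KP-small K-uniformly = «the RG reaches the high-temperature domain», X5-wall declared).  The seam
`exitPurityInf_of_exitColdPressure` picks `N` with `C N³ e^{−cN} ≤ θ` once (K-uniform `C, c`), for EVERY `θ > 0`. -/
section KPExit
variable {G : Type} [Group G] [TopologicalSpace G] [IsTopologicalGroup G] [CompactSpace G]
  [MeasurableSpace G] [BorelSpace G]

/-- Exit-unit cold pressure at depth `K` with constants `C, c` (all coarse box sizes `N' ≥ 2`). -/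
def ExitColdPressureAt {n : ℕ} (ρ : G →* Matrix (Fin n) (Fin n) ℂ) (b : ℕ) (β : ℕ → ℝ) (C c : ℝ) (K : ℕ) : Prop :=
  ∀ N' : ℕ, 2 ≤ N' → coldDefect ρ (β K) (exitBox b N' K) ≤ C * (N' : ℝ) ^ 3 * Real.exp (-(c * N'))

/-- K-uniform exit-unit cold pressure for infinitely many depths (liminf form, as (E)). -/
def ExitColdPressureInf {n : ℕ} (ρ : G →* Matrix (Fin n) (Fin n) ℂ) (b : ℕ) (β : ℕ → ℝ) : Prop :=
  ∃ C c : ℝ, 0 < c ∧ ∀ K₀ : ℕ, ∃ K : ℕ, K₀ ≤ K ∧ ExitColdPressureAt ρ b β C c K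

/-- Real-analysis helper: `C·N³·e^{−cN} ≤ θ` for all large `N` (`c > 0`, `θ > 0`). -/
theorem eventually_cube_mul_exp_le {C c θ : ℝ} (hc : 0 < c) (hθ : 0 < θ) :
    ∀ᶠ N : ℕ in atTop, C * (N : ℝ) ^ 3 * Real.exp (-(c * N)) ≤ θ := by
  have h1 : Tendsto (fun N : ℕ => c * (N : ℝ)) atTop atTop :=
    tendsto_natCast_atTop_atTop.const_mul_atTop hc
  have h2 : Tendsto (fun N : ℕ => (c * (N : ℝ)) ^ 3 * Real.exp (-(c * N))) atTop (𝓝 0) :=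
    (Real.tendsto_pow_mul_exp_neg_atTop_nhds_zero 3).comp h1
  have h3 : Tendsto (fun N : ℕ => C / c ^ 3 * ((c * (N : ℝ)) ^ 3 * Real.exp (-(c * N)))) atTop (𝓝 (C / c ^ 3 * 0)) :=
    h2.const_mul _
  rw [mul_zero] at h3
  have h4 := (tendsto_order.1 h3).2 θ hθ
  filter_upwards [h4] with N hN
  have hc0 : c ≠ 0 := hc.ne'
  have : C * (N : ℝ) ^ 3 * Real.exp (-(c * N)) = C / c ^ 3 * ((c * (N : ℝ)) ^ 3 * Real.exp (-(c * N))) := by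
    field_simp
  rw [this]; exact hN.le

/-- **Seam** (PROVED): K-uniform exit-unit cold pressure ⇒ (E) for every tolerance `θ > 0`, with ONE box size `N`. -/
theorem exitPurityInf_of_exitColdPressure {n : ℕ} (ρ : G →* Matrix (Fin n) (Fin n) ℂ) (b : ℕ) (β : ℕ → ℝ)
    (h : ExitColdPressureInf ρ b β) {θ : ℝ} (hθ : 0 < θ) :
    ∃ N : ℕ, 2 ≤ N ∧ ExitPurityInf ρ b N β θ := by
  obtain ⟨C, c, hc, hK⟩ := h
  obtain ⟨N, hN⟩ := eventually_atTop.1 ((eventually_cube_mul_exp_le (C := C) hc hθ).and (eventually_ge_atTop 2))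
  refine ⟨N, (hN N le_rfl).2, fun K₀ => ?_⟩
  obtain ⟨K, hKK, hcp⟩ := hK K₀
  exact ⟨K, hKK, (hcp N (hN N le_rfl).2).trans (hN N le_rfl).1⟩

/-- Pin monotonicity in the box parameter: a pin for `N = 1` boxes (`4·b^K`) pins the `N`-boxes with `T·N`. -/
theorem trajectoryPin_of_N_one (r : LatticeRep G) (b N : ℕ) (β : ℕ → ℝ) (h : TrajectoryPin r b 1 β) :
    TrajectoryPin r b N β := by
  intro a ha hlim hfl
  obtain ⟨T, hT⟩ := h a ha hlim hfl
  refine ⟨T * N, ?_⟩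
  filter_upwards [hT] with K hK
  have hE : (exitBox b N K : ℝ) = (exitBox b 1 K : ℝ) * N := by
    simp only [exitBox, Nat.cast_mul, Nat.cast_pow, Nat.cast_ofNat, Nat.cast_one]; ring
  rw [hE, ← mul_assoc]
  exact mul_le_mul_of_nonneg_right hK (Nat.cast_nonneg N)

end KPExit

/-- **`KPExitLadder`** (card `kp-exit`): ONE trajectory with K-uniform EXIT-UNIT cold pressure for infinitely many depths (K-A, IR, X5-wall)
and the unit-box pin (Xπ₁, UV).  Tolerance-free. -/
def KPExitLadder : Prop :=
  ∀ (G : Type) [Group G] [TopologicalSpace G] [IsTopologicalGroup G] [CompactSpace G],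
    IsCompactSimpleLieGroup G → SimplyConnectedSpace G →
    letI : MeasurableSpace G := borel G
    haveI : BorelSpace G := ⟨rfl⟩
    ∀ r : LatticeRep G, ∃ (b : ℕ) (β : ℕ → ℝ), 2 ≤ b ∧ Tendsto β atTop atTop ∧
      ExitColdPressureInf r.ρ b β ∧ TrajectoryPin r b 1 β

/-- **Seam** (PROVED): `KPExitLadder → RGExitLadderAt θ` for EVERY `θ > 0` (hence PXcof(θ) for all `θ > 0`, cf. tolerance invariance p630048). -/
theorem rgExitLadder_of_kpExit (h : KPExitLadder) {θ : ℝ} (hθ : 0 < θ) : RGExitLadderAt θ := by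
  intro G _ _ _ _ hG hsc
  letI : MeasurableSpace G := borel G
  haveI : BorelSpace G := ⟨rfl⟩
  intro r
  obtain ⟨b, β, hb, hβ, hcp, hpin⟩ := h G hG hsc r
  obtain ⟨N, hN, hE⟩ := exitPurityInf_of_exitColdPressure r.ρ b β hcp hθ
  exact ⟨b, N, β, hb, hN, hβ, hE, trajectoryPin_of_N_one r b N β hpin⟩

/-- NAMED STUB of card `kp-exit`. -/
theorem stub_kpExitLadder : KPExitLadder := by
  sorry

/-- Hence PXcof at every positive tolerance. -/
theorem pxcof_of_kpExit (h : KPExitLadder) {θ : ℝ} (hθ : 0 < θ) : PinnedExitsCofinalAt θ :=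
  pxcof_of_rgExitLadder (rgExitLadder_of_kpExit h hθ)

end Summit.QuantumFields.YangMills.Cruxes.IRcof.RGExitColdPressure
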